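import Literature.AnabelianGeometry.EtaleTheta.SettingModelSlice2TheoremR2
import HarnessLib

/-!
# (L3′) slice 2, file 14 — NON-VACUITY GUARD for the hypothesis bundles of Theorem R2 / Corollary (L3′)

TRIVIAL PARAMETERS (Ψ = id, f′ = 1, U₀ = ⊤, m = l) — NOT the data of CELL hextΔ/hΘ@modelTate; a non-vacuity guard,
asserts nothing about the cell; MORATORIUM §F v1.19er (E).

PROOF-ONLY (theorem-only; no definition, instance or notation).  The four `Prop`-valued hypothesis bundles of the
slice-2 chain — `Residual` (the one-sentence residual of record), `Original`, `OriginalSlim` (and, through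
`Residual.axisPinned_or`, `AxisPinned`) — are INHABITED at every level `l ≥ 1` by the identity map of OUR
semi-synthetic `F̂₂ = F₂hatT` with `f′ = 1`, the full torus `U₀ = ⊤ ≤ G_{ℚ_p}` and `m = l`; and the landed
`Slice2.theoremR2` / `Slice2.Original.corollaryL3` FIRE at those parameters.  So THEOREM R2 and COROLLARY (L3′) as filed
(`SettingModelSlice2TheoremR2`) are statements about a NON-EMPTY class of maps — nothing more is claimed here.
The witnesses are those of the independent pre-filing audit of abc-iut-f-193 (gen 28, `ProbeR1_D5_NVPIN`
4095aff2bbaa3f37, NV-1/2/3 and FIRE-1/2), re-typed against the landed modules by abc-iut-L6-t19 (gen 24) under ruling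
§F v1.19hb (P)(2).  GUARD: no witness at any other parameter; no decider / equivalence / negative declaration; nothing of
[EtTh]/[IUTchII]/[IUTchIII] in print is asserted (cf. [EtTh] §1–§2 for the role the objects play there); no side is taken
on [IUTchIII] Cor. 3.12; nothing here asserts abc proved or refuted.
-/

noncomputable section

namespace Literature.AnabelianGeometry.EtaleTheta.SettingModel.Slice2.NonVacuity

open Literature.AnabelianGeometry.EtaleTheta.SettingModel
open Literature.AnabelianGeometry.EtaleTheta.SettingModel.Slice2
open Literature.AnabelianGeometry.SemiGraphs (GQp)

/-- **NV-1.** The residual hypotheses `Residual` are INHABITED at the TRIVIAL PARAMETERS `Ψ = id`, `f′ = 1`, `U₀ = ⊤`,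
`m = l`, for every level `l` (every law holds on the nose with cocycle value `1`).  NOT the data of CELL
hextΔ/hΘ@modelTate; a non-vacuity guard only (cf. [EtTh] §1). [cite: MochizukiEtTh2009, §1 p.12] -/
theorem residual_trivial (p : ℕ) [Fact p.Prime] (l : ℕ+) : Residual p l (⊤ : Subgroup (GQp p)) l 1 id where
  dvd := dvd_rfl
  mul := fun _ _ _ _ => rfl
  cont := continuous_subtype_val
  inj := fun _ _ _ _ h => h
  mapsTo := fun x hx => by simpa using hx
  torus := fun _ _ _ _ => rfl
  btype := fun _ _ => Iff.rfl
  axis := fun _ _ => Iff.rfl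
  dlaw := fun _ => ⟨1, fun _ _ => by simp⟩

/-- **NV-2.** The original laws `Original` (torus law with a cocycle, here `η = 1`) are INHABITED at the TRIVIAL
PARAMETERS `Ψ = id`, `U₀ = ⊤`, `m = l`, for every `l`.  NOT the data of CELL hextΔ/hΘ@modelTate; a non-vacuity guard only
(cf. [EtTh] §1). [cite: MochizukiEtTh2009, §1 p.12] -/
theorem original_trivial (p : ℕ) [Fact p.Prime] (l : ℕ+) : Original p l (⊤ : Subgroup (GQp p)) l id where
  dvd := dvd_rfl
  mul := fun _ _ _ _ => rfl
  cont := continuous_subtype_val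
  inj := fun _ _ _ _ h => h
  mapsTo := fun _ hx => hx
  surj := fun y hy => ⟨y, hy, rfl⟩
  torus := ⟨fun _ => 1, fun _ _ _ _ => by simp, fun _ _ _ _ => by simp⟩
  btype := fun _ _ => Iff.rfl
  dlaw := fun _ => ⟨1, fun _ _ => by simp⟩

/-- **NV-3.** The slim original laws `OriginalSlim` (torus law with SOME `η_σ`, no cocycle identity) are INHABITED at the
TRIVIAL PARAMETERS `Ψ = id`, `U₀ = ⊤`, `m = l`, for every `l`.  NOT the data of CELL hextΔ/hΘ@modelTate; a non-vacuity
guard only (cf. [EtTh] §1). [cite: MochizukiEtTh2009, §1 p.12] -/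
theorem originalSlim_trivial (p : ℕ) [Fact p.Prime] (l : ℕ+) : OriginalSlim p l (⊤ : Subgroup (GQp p)) l id where
  dvd := dvd_rfl
  mul := fun _ _ _ _ => rfl
  cont := continuous_subtype_val
  inj := fun _ _ _ _ h => h
  mapsTo := fun _ hx => hx
  surj := fun y hy => ⟨y, hy, rfl⟩
  torus := ⟨fun _ => 1, fun _ _ _ _ => by simp⟩
  btype := fun _ _ => Iff.rfl
  dlaw := fun _ => ⟨1, fun _ _ => by simp⟩

/-- **FIRE-1.** The landed THEOREM R2 (`Slice2.theoremR2`, every `l`, no hypothesis on `l`) APPLIES at the trivial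
parameters of NV-1 (over `G_{ℚ_p}` for any prime `p`, which the conclusion does not mention) — its hypothesis bundle is not vacuous.  (The conclusion is of course trivial here; the point is only
that the theorem's antecedent is satisfiable.)  NOT the data of CELL hextΔ/hΘ@modelTate (cf. [EtTh] §1).
[cite: MochizukiEtTh2009, §1 p.12] -/
theorem theoremR2_fires_trivial (p : ℕ) [Fact p.Prime] (l : ℕ+) :
    ((∀ x ∈ Uhat l, (id x : F₂hatT) = x) ∨ (∀ x ∈ Uhat l, (id x : F₂hatT) = sigmaHat x)) ∧
      (∀ y : F₂hatT, (1 : F₂hatT) * y * 1⁻¹ ∈ Uhat l ↔ y ∈ Uhat l) ∧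
      (∀ k : ZH, ∀ x ∈ Uhat l, id (Dp (k ^ ((l : ℕ+) : ℕ)) x) = Dp (k ^ ((l : ℕ+) : ℕ)) (id x)) :=
  theoremR2 (residual_trivial p l)

/-- **FIRE-2.** The landed COROLLARY (L3′) (`Slice2.Original.corollaryL3`, every `l`) APPLIES at the trivial parameters of
NV-2 (any prime `p`; the conclusion does not mention it) — its hypothesis bundle is not vacuous.  NOT the data of CELL hextΔ/hΘ@modelTate (cf. [EtTh] §1).
[cite: MochizukiEtTh2009, §1 p.12] -/
theorem corollaryL3_fires_trivial (p : ℕ) [Fact p.Prime] (l : ℕ+) :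
    ∃ f : F₂hatT, (∀ y : F₂hatT, f * y * f⁻¹ ∈ Uhat l ↔ y ∈ Uhat l) ∧
      ((∀ x ∈ Uhat l, id x = f * x * f⁻¹) ∨ (∀ x ∈ Uhat l, id x = f * sigmaHat x * f⁻¹)) :=
  (original_trivial p l).corollaryL3

end Literature.AnabelianGeometry.EtaleTheta.SettingModel.Slice2.NonVacuity

end
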